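import Mathlib
import Literature.Algebra.Homology.HerbrandQuotientEndomorphisms
import HarnessLib

/-!
# Non-square descent — THE CAPITULATION KERNEL IS BOUNDED BY THE MAXIMAL FINITE SUBMODULE: `#ker(X/ω_nX → X/ω_mX, x ↦ ν_{m,n}x) ∣ #X[ν_{m,n}] ≤ #F`
# (the last module-algebra link of stub S2's Herbrand/capitulation bound «… capitulation `≤ #X^χ[ν_{m,n}] ≤ #F^χ`» of line `nonsquare-descent`) —
# seed crux `SignedMuSeedAtTwoPlus` stmt-BirchSwinnertonDyer-21438 (parent Kμ⁺ `SignedMuVanishingAtTwoPlus` stmt-BirchSwinnertonDyer-20689,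
# route ResidualThetaTransportAtTwo), line card `Cruxes/SignedMuSeedAtTwoPlus/Lines/nonsquare-descent.md`

Cell `bsd-wall`, width seat `bsd-wall-rtt-p4-w2` g19 (`--supports`, closes nothing).  THEOREMS ONLY; BSD is not proved by this and nothing
arithmetic is asserted: module algebra over a commutative (Noetherian, where said) ring, in the index currency `Herbrand.index T S = |T/(S ∩ T)|`.

The card (stub S2): «capitulation `≤ #X^χ[ν_{m,n}] ≤ #F^χ` because `𝔓` is the unique, totally ramified prime».  The ARITHMETIC input is the
identification `A_k^χ ≅ X^χ/ω_k X^χ` under which the extension-of-ideals map `A_n → A_m` becomes `x ↦ ν_{m,n} x : X/ω_nX → X/ω_mX`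
(`ω_m = ν_{m,n} ω_n`).  Everything after that is module algebra and is here, for an `R`-module `X` and scalars `ω ν` (`ω_n`, `ν_{m,n}`):

* §1 `smul_top_le_comap_lsmul` (`ν` maps `ωX` into `(νω)X`), `comap_lsmul_smul_top_eq` (`{x | νx ∈ νωX} = X[ν] + ωX`, ANY commutative ring),
  `ker_capitulation_eq`, **`natCard_ker_capitulation_eq`** (`#ker(X/ωX → X/νωX) = (X[ν] : ωX)`), **`natCard_ker_capitulation_dvd`**
  (`∣ #X[ν]`; `Nat.card`, unconditional).
* §2 `X[a]` IS FINITE WHEN `X/aX` IS (`R` Noetherian, `X` finitely generated): `finite_range_of_smul_top_le_ker`, `finite_quotient_pow_smul_top`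
  (`X/aⁿX` finite), `torsionBy_inf_pow_smul_top_eq_bot` (ARTIN–REES: `X[a] ∩ a^{k+1}X = 0` for some `k`, Mathlib `Ideal.exists_pow_inf_eq_pow_smul`),
  **`finite_torsionBy_of_finite_quotient`**; `finite_quotient_smul_top_of_dvd` (`X/νωX` finite ⟹ `X/νX` finite).
* §3 THE MAXIMAL FINITE SUBMODULE of a Noetherian module: `finite_sup_of_finite`, **`exists_maximal_finite_submodule`**
  (`∃ F` finite with `F' ≤ F` for every finite `F'`), `natCard_le_of_le`.
* §4 composed: **`natCard_ker_capitulation_le`** — `#ker(X/ω_nX → X/ω_mX) ≤ #F` for the maximal finite submodule `F`, as soon as `X/ω_mX` is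
  finite («`#ker(A_n^χ → A_m^χ) ≤ #F^χ`, uniformly in `m ≥ n`»).

With `…HerbrandIndex`, `…HilbertNinety`, `…CapitulationSplit`, `…UniversalNorms` (this seat) and g18's `…NormIndexSplit` this completes the
module-algebra skeleton of «`#B'_n ≤ #F^χ · #(Q'/ω_nQ')`»; what a LEAD still feeds is arithmetic only (S1; `A_k^χ ≅ X^χ/ω_k` with its maps;
`[I^{G,χ} : I_n^χ] = 1`; Hilbert 90 ⊗ 𝒪).  [folklore]
-/

set_option autoImplicit false
-- the Theorems namespace of this sub repeats the summit name by design (D-0017 nested layout)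
set_option linter.dupNamespace false

open scoped Pointwise
open Literature.Algebra.Homology

namespace Summit.BirchSwinnertonDyer.BirchSwinnertonDyer.Theorems.SignedMuAtTwo.NonsquareDescent

universe u v

variable {R : Type u} [CommRing R] {X : Type v} [AddCommGroup X] [Module R X]

/-! ## §1 The capitulation map `x ↦ νx : X/ωX → X/νωX` and its kernel `(X[ν] + ωX)/ωX` -/

/-- `ν` maps `ωX` into `(ν ω)X`, so `x ↦ νx` induces `X/ωX → X/νωX`. [folklore] -/
theorem smul_top_le_comap_lsmul (ω ν : R) :
    ω • (⊤ : Submodule R X) ≤ ((ν * ω) • (⊤ : Submodule R X)).comap (DistribSMul.toLinearMap R X ν) := by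
  intro x hx
  rw [Submodule.mem_smul_pointwise_iff_exists] at hx
  obtain ⟨y, -, rfl⟩ := hx
  rw [Submodule.mem_comap, DistribSMul.toLinearMap_apply, smul_smul]
  exact Submodule.smul_mem_pointwise_smul _ _ _ Submodule.mem_top

/-- **`{x | νx ∈ νωX} = X[ν] + ωX`** (any commutative ring: `νx = νωy` gives `x = (x − ωy) + ωy`). [folklore] -/
theorem comap_lsmul_smul_top_eq (ω ν : R) :
    ((ν * ω) • (⊤ : Submodule R X)).comap (DistribSMul.toLinearMap R X ν) =
      Submodule.torsionBy R X ν ⊔ ω • (⊤ : Submodule R X) := by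
  ext x
  rw [Submodule.mem_comap, DistribSMul.toLinearMap_apply, Submodule.mem_smul_pointwise_iff_exists, Submodule.mem_sup]
  constructor
  · rintro ⟨y, -, hy⟩
    refine ⟨x - ω • y, ?_, ω • y, Submodule.smul_mem_pointwise_smul _ _ _ Submodule.mem_top, sub_add_cancel x _⟩
    rw [Submodule.mem_torsionBy_iff, smul_sub, smul_smul, hy, sub_self]
  · rintro ⟨t, ht, z, hz, rfl⟩
    rw [Submodule.mem_torsionBy_iff] at ht
    rw [Submodule.mem_smul_pointwise_iff_exists] at hz
    obtain ⟨y, -, rfl⟩ := hz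
    exact ⟨y, Submodule.mem_top, by rw [smul_add, ht, zero_add, smul_smul]⟩

/-- The kernel of `X/ωX → X/νωX` is the image of `X[ν] + ωX`. [folklore] -/
theorem ker_capitulation_eq (ω ν : R) :
    LinearMap.ker (Submodule.mapQ (ω • (⊤ : Submodule R X)) ((ν * ω) • (⊤ : Submodule R X))
        (DistribSMul.toLinearMap R X ν) (smul_top_le_comap_lsmul ω ν)) =
      (Submodule.torsionBy R X ν ⊔ ω • (⊤ : Submodule R X)).map (ω • (⊤ : Submodule R X)).mkQ := by
  unfold Submodule.mapQ
  rw [Submodule.ker_liftQ, LinearMap.ker_comp, Submodule.ker_mkQ, comap_lsmul_smul_top_eq]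

/-- **`#ker(X/ωX → X/νωX) = (X[ν] : ωX)`** (`Nat.card`, unconditional). [folklore] -/
theorem natCard_ker_capitulation_eq (ω ν : R) :
    Nat.card (LinearMap.ker (Submodule.mapQ (ω • (⊤ : Submodule R X)) ((ν * ω) • (⊤ : Submodule R X))
        (DistribSMul.toLinearMap R X ν) (smul_top_le_comap_lsmul ω ν))) =
      Herbrand.index (Submodule.torsionBy R X ν) (ω • (⊤ : Submodule R X)) := by
  rw [ker_capitulation_eq, ← Herbrand.index_eq_card_map_mkQ, Herbrand.index_sup]

/-- `(T : S) ∣ |T|` (`Nat.card`). [folklore] -/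
theorem index_dvd_natCard (T S : Submodule R X) : Herbrand.index T S ∣ Nat.card T := by
  rw [← Herbrand.index_inf_right]
  exact Dvd.intro _ (Herbrand.card_eq_index_mul_card (inf_le_right : S ⊓ T ≤ T)).symm

/-- **`#ker(X/ωX → X/νωX) ∣ #X[ν]`** — «`#ker(A_n → A_m) ∣ #X[ν_{m,n}]`» (`Nat.card`, unconditional). [folklore] -/
theorem natCard_ker_capitulation_dvd (ω ν : R) :
    Nat.card (LinearMap.ker (Submodule.mapQ (ω • (⊤ : Submodule R X)) ((ν * ω) • (⊤ : Submodule R X))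
        (DistribSMul.toLinearMap R X ν) (smul_top_le_comap_lsmul ω ν))) ∣
      Nat.card (Submodule.torsionBy R X ν) := by
  rw [natCard_ker_capitulation_eq]
  exact index_dvd_natCard _ _

/-! ## §2 `X[a]` is finite when `X/aX` is (`R` Noetherian, `X` finitely generated): Artin–Rees -/

section Finiteness

/-- The range of a linear map killing `aX` is finite when `X/aX` is. [folklore] -/
theorem finite_range_of_smul_top_le_ker {Y : Type*} [AddCommGroup Y] [Module R Y] (a : R) (g : X →ₗ[R] Y)
    (hg : a • (⊤ : Submodule R X) ≤ LinearMap.ker g) [Finite (X ⧸ a • (⊤ : Submodule R X))] :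
    Finite (LinearMap.range g) := by
  have hr : LinearMap.range ((a • (⊤ : Submodule R X)).liftQ g hg) = LinearMap.range g := Submodule.range_liftQ _ _ _
  rw [← hr]
  exact Finite.of_surjective _ (LinearMap.surjective_rangeRestrict _)

/-- **`X/aⁿX` is finite for every `n` when `X/aX` is** (`aⁿX/aⁿ⁺¹X` is the range of `x ↦ aⁿx mod aⁿ⁺¹X`, which kills `aX`). [folklore] -/
theorem finite_quotient_pow_smul_top (a : R) [Finite (X ⧸ a • (⊤ : Submodule R X))] (n : ℕ) :
    Finite (X ⧸ a ^ n • (⊤ : Submodule R X)) := by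
  induction n with
  | zero =>
    rw [pow_zero, one_smul]
    infer_instance
  | succ n ih =>
    -- the kernel of `X/a^{n+1}X → X/a^nX` is the range of `x ↦ a^n x mod a^{n+1}X`
    have hle : a ^ (n + 1) • (⊤ : Submodule R X) ≤ a ^ n • (⊤ : Submodule R X) := by
      intro x hx
      rw [Submodule.mem_smul_pointwise_iff_exists] at hx
      obtain ⟨y, -, rfl⟩ := hx
      rw [pow_succ, mul_smul]
      exact Submodule.smul_mem_pointwise_smul _ _ _ Submodule.mem_top
    set g : X →ₗ[R] X ⧸ a ^ (n + 1) • (⊤ : Submodule R X) :=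
      (a ^ (n + 1) • (⊤ : Submodule R X)).mkQ ∘ₗ DistribSMul.toLinearMap R X (a ^ n) with hgdef
    have hg : a • (⊤ : Submodule R X) ≤ LinearMap.ker g := by
      intro x hx
      rw [Submodule.mem_smul_pointwise_iff_exists] at hx
      obtain ⟨y, -, rfl⟩ := hx
      rw [LinearMap.mem_ker, hgdef, LinearMap.comp_apply, DistribSMul.toLinearMap_apply, Submodule.mkQ_apply,
        Submodule.Quotient.mk_eq_zero, smul_smul, ← pow_succ]
      exact Submodule.smul_mem_pointwise_smul _ _ _ Submodule.mem_top
    haveI hfinK : Finite (LinearMap.range g) := finite_range_of_smul_top_le_ker a g hg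
    -- that range is the kernel of the projection `X/a^{n+1}X → X/a^nX`
    have hrange : LinearMap.range g = (a ^ n • (⊤ : Submodule R X)).map (a ^ (n + 1) • (⊤ : Submodule R X)).mkQ := by
      rw [hgdef, LinearMap.range_comp, LinearMap.range_eq_map]
      rfl
    have key := Submodule.card_quotient_mul_card_quotient (a ^ n • (⊤ : Submodule R X)) (a ^ (n + 1) • ⊤) hle
    rw [← hrange] at key
    refine Nat.finite_of_card_ne_zero ?_
    rw [← key]
    exact mul_ne_zero Nat.card_pos.ne' Nat.card_pos.ne'

/-- **ARTIN–REES: `X[a] ∩ a^{k+1}X = 0` for some `k`** (`R` Noetherian, `X` finitely generated): Mathlib's `Ideal.exists_pow_inf_eq_pow_smul`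
gives `(a)^{k+1}X ∩ X[a] = (a)·((a)^kX ∩ X[a]) ⊆ a·X[a] = 0`. [folklore] -/
theorem torsionBy_inf_pow_smul_top_eq_bot [IsNoetherianRing R] [Module.Finite R X] (a : R) :
    ∃ k : ℕ, Submodule.torsionBy R X a ⊓ a ^ (k + 1) • (⊤ : Submodule R X) = ⊥ := by
  obtain ⟨k, hk⟩ := Ideal.exists_pow_inf_eq_pow_smul (Ideal.span {a}) (Submodule.torsionBy R X a)
  refine ⟨k, ?_⟩
  have h := hk (k + 1) (Nat.le_succ k)
  rw [Nat.add_sub_cancel_left, pow_one] at h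
  rw [inf_comm, ← Submodule.ideal_span_singleton_smul, ← Ideal.span_singleton_pow, h, Submodule.eq_bot_iff]
  intro x hx
  have hle : Ideal.span {a} • (Ideal.span {a} ^ k • ⊤ ⊓ Submodule.torsionBy R X a) ≤
      Ideal.span {a} • Submodule.torsionBy R X a := Submodule.smul_mono le_rfl inf_le_right
  have hx' := hle hx
  rw [Submodule.ideal_span_singleton_smul, Submodule.mem_smul_pointwise_iff_exists] at hx'
  obtain ⟨t, ht, rfl⟩ := hx'
  rwa [Submodule.mem_torsionBy_iff] at ht

/-- **`X[a]` IS FINITE WHEN `X/aX` IS** (`R` Noetherian, `X` finitely generated): `X[a] ↪ X/a^{k+1}X` by Artin–Rees.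
(«`X^χ[ν_{m,n}]` is finite because `A_m^χ = X^χ/ω_m` is».) [folklore] -/
theorem finite_torsionBy_of_finite_quotient [IsNoetherianRing R] [Module.Finite R X] (a : R)
    [Finite (X ⧸ a • (⊤ : Submodule R X))] : Finite (Submodule.torsionBy R X a) := by
  obtain ⟨k, hk⟩ := torsionBy_inf_pow_smul_top_eq_bot (X := X) a
  haveI := finite_quotient_pow_smul_top (X := X) a (k + 1)
  refine Finite.of_injective (fun t : Submodule.torsionBy R X a => (a ^ (k + 1) • (⊤ : Submodule R X)).mkQ (t : X))
    fun t t' h => ?_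
  have h' : ((t : X) - (t' : X)) ∈ Submodule.torsionBy R X a ⊓ a ^ (k + 1) • (⊤ : Submodule R X) := by
    refine Submodule.mem_inf.2 ⟨Submodule.sub_mem _ t.2 t'.2, ?_⟩
    rw [← Submodule.Quotient.eq, ← Submodule.mkQ_apply, ← Submodule.mkQ_apply]
    exact h
  rw [hk, Submodule.mem_bot, sub_eq_zero] at h'
  exact Subtype.ext h'

/-- `X/νX` is finite when `X/νωX` is (`νωX ≤ νX`). [folklore] -/
theorem finite_quotient_smul_top_of_mul (ω ν : R) [Finite (X ⧸ (ν * ω) • (⊤ : Submodule R X))] :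
    Finite (X ⧸ ν • (⊤ : Submodule R X)) := by
  have hle : (ν * ω) • (⊤ : Submodule R X) ≤ ν • (⊤ : Submodule R X) := by
    intro x hx
    rw [Submodule.mem_smul_pointwise_iff_exists] at hx
    obtain ⟨y, -, rfl⟩ := hx
    rw [mul_smul]
    exact Submodule.smul_mem_pointwise_smul _ _ _ Submodule.mem_top
  exact Finite.of_surjective _ (Submodule.factor_surjective hle)

end Finiteness

/-! ## §3 The maximal finite submodule of a Noetherian module -/

section MaximalFinite

/-- The sum of two finite submodules is finite. [folklore] -/
theorem finite_sup_of_finite (F F' : Submodule R X) [Finite F] [Finite F'] : Finite ↥(F ⊔ F') := by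
  rw [Submodule.sup_eq_range]
  exact Finite.of_surjective _ (LinearMap.surjective_rangeRestrict _)

/-- **THE MAXIMAL FINITE SUBMODULE EXISTS** for a Noetherian module: there is a finite submodule `F` containing every finite submodule
(a maximal element of the set of finite submodules; it absorbs every finite `F'` since `F + F'` is finite).  («`F^χ` = the maximal finite
`Λ`-submodule of `X^χ`».) [folklore] -/
theorem exists_maximal_finite_submodule [IsNoetherian R X] :
    ∃ F : Submodule R X, Finite F ∧ ∀ F' : Submodule R X, Finite F' → F' ≤ F := by
  obtain ⟨F, hF, hmax⟩ := set_has_maximal_iff_noetherian.2 (inferInstance : IsNoetherian R X)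
    {F : Submodule R X | Finite F} ⟨⊥, (inferInstance : Finite (⊥ : Submodule R X))⟩
  refine ⟨F, hF, fun F' hF' => ?_⟩
  haveI : Finite F := hF
  haveI : Finite F' := hF'
  have hsup : Finite ↥(F ⊔ F') := finite_sup_of_finite F F'
  have hnlt := hmax (F ⊔ F') hsup
  have heq : F ⊔ F' = F := (eq_of_le_of_not_lt le_sup_left hnlt).symm
  exact le_sup_right.trans heq.le

/-- `F' ≤ F ⟹ |F'| ≤ |F|` for `F` finite. [folklore] -/
theorem natCard_le_of_le {F F' : Submodule R X} [Finite F] (h : F' ≤ F) : Nat.card F' ≤ Nat.card F :=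
  Nat.card_le_card_of_injective (Submodule.inclusion h) (Submodule.inclusion_injective h)

end MaximalFinite

/-! ## §4 `#ker(X/ω_nX → X/ω_mX) ≤ #F` -/

/-- **THE CAPITULATION KERNEL IS BOUNDED BY THE MAXIMAL FINITE SUBMODULE**: for `X` finitely generated over a Noetherian `R`, `ω ν ∈ R` with
`X/νωX` finite, and `F` a finite submodule containing every finite submodule, `#ker(x ↦ νx : X/ωX → X/νωX) ≤ #F`.
(«`#ker(A_n^χ → A_m^χ) ≤ #X^χ[ν_{m,n}] ≤ #F^χ`, uniformly in `m ≥ n`».) [folklore] -/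
theorem natCard_ker_capitulation_le [IsNoetherianRing R] [Module.Finite R X] (ω ν : R)
    [Finite (X ⧸ (ν * ω) • (⊤ : Submodule R X))] {F : Submodule R X} (hFfin : Finite F)
    (hF : ∀ F' : Submodule R X, Finite F' → F' ≤ F) :
    Nat.card (LinearMap.ker (Submodule.mapQ (ω • (⊤ : Submodule R X)) ((ν * ω) • (⊤ : Submodule R X))
        (DistribSMul.toLinearMap R X ν) (smul_top_le_comap_lsmul ω ν))) ≤ Nat.card F := by
  haveI := finite_quotient_smul_top_of_mul (X := X) ω ν
  haveI hfin : Finite (Submodule.torsionBy R X ν) := finite_torsionBy_of_finite_quotient ν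
  haveI := hFfin
  exact (Nat.le_of_dvd Nat.card_pos (natCard_ker_capitulation_dvd ω ν)).trans (natCard_le_of_le (hF _ hfin))

end Summit.BirchSwinnertonDyer.BirchSwinnertonDyer.Theorems.SignedMuAtTwo.NonsquareDescent
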